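import Summits.QuantumFields.GaugeBoot.DiagonalRPTorusRestFins
import HarnessLib

/-!
# The shape of a rest cluster joining a top-inner column to a mirror-side column (gauge-boot,
task L3 sequel `d = 3`, `L = 4`; 3/5)

HONEST FRAMING (cell `pub-gaugeboot`, page 1 of every file): the venture produces certified bounds
on lattice expectations at stated coupling, gauge group, dimension and torus size; NOT a mass gap,
NOT a continuum limit, NOT a string tension; NOT Yang–Mills-summit-bearing (barriers
`FixedCouplingUltralocality`, `PerturbativeInvisibility`). This module is the combinatorial core
of a structural NEGATIVE result (`DiagonalRPTorusInnerHalfNegativeThreeAll`); it discharges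
nothing by itself.

## Content (three-torus `(ℤ/L)³`, `L = 2c`, `c ≥ 2` — so `L = 4` is allowed — mirror `x₀ = x₁`)

Let `A` be a column on the top inner layer `δ(A) = c - 1` and `A'` a column on its mirror image
`δ(A') = -(c - 1)` (`δ(a,b) = a - b`); they are distinct and not adjacent (`ne_and_not_adj`: the
layers differ by `2 ∉ {0, ±1}` in `ℤ/L`, `L ≥ 4`). Let `S ⊆ restPlaqs 0 1 c` cover both columns
with `|S| ≤ 2L`. By `DiagRPSUN.exists_fins`, `S` is exactly one fin per vertical link; by
`DiagonalRPTorusRestFins` a fin over `A` is `(vsite A z; 0,2)` (type 0, outer column `A + e₀`) or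
`(vsite (A - e₁) z; 1,2)` (type 1, outer column `A - e₁`), a fin over `A'` is
`(vsite (A' - e₀) z; 0,2)` (type 0') or `(vsite A' z; 1,2)` (type 1').

**`rest_shape`**: either `S` has a LONELY LINK (a link of some `p ∈ S` in no other plaquette of
`S` and on neither column — then the pair term `T_S(A',A)` vanishes by
`DiagRPSUN.pairTerm_eq_zero_of_lonely`), or one of
* `A' = A + 2e₀` and `S = band A (0,2)` (the two ladders over `A` and `A + e₀`),
* `A = A' + 2e₁` and `S = band A' (1,2)`,
* `A' + e₁ = A + e₀`.
Mechanism: a change of fin type along a column leaves the top rung of the lower fin lonely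
(`(0,1)`-plaquettes contain no vertical link, so they are not fins and not in `S`); with uniform
types the outer vertical link of the fin over `A` at height `0` must lie in the fin over `A'` at
height `0`, which forces the outer columns to agree. No hypothesis `L ≥ 5` (contrast
`DiagRPSUN.exists_lonely_of_ne_band`): restricted to the rest, the competing covers through the
inner half and through the mirror half are absent.

Elementary combinatorics; no named fact.
-/

open Finset Function

namespace Summit.QuantumFields.GaugeBoot

open Literature.MathematicalPhysics.QuantumFieldTheory

namespace DiagRPRest

open DiagRPThree DiagRPPolyakov DiagRPSUN
open DiagRPTube (restPlaqs cast_pred_add_one)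

variable {L : ℕ}

/-! ## Small facts -/

section Small

/-- The two vertical coordinate planes differ. -/
theorem plane02_ne_plane12 : (plane02 : {q : Fin 3 × Fin 3 // q.1 < q.2}) ≠ plane12 := by
  simp [plane02, plane12]

/-- Horizontal steps commute: `B + e₀ + e₁ = B + e₁ + e₀`. -/
theorem bump_zero_bump_one (B : ZMod L × ZMod L) : bump 0 (bump 1 B) = bump 1 (bump 0 B) := by
  rw [bump_zero, bump_zero, bump_one, bump_one]

/-- Vertical links of a `(0,2)`-fin: `(vsite B w; 0,2) ∋ (vsite C z, 2)` iff `z = w`, `C ∈ {B, B+e₀}`. -/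
theorem vertical_link_plane02 (B : ZMod L × ZMod L) (w : ZMod L) {C : ZMod L × ZMod L} {z : ZMod L}
    (h : pcnt (vsite B w, plane02) (vsite C z, 2) ≠ 0) : z = w ∧ (C = B ∨ C = bump 0 B) :=
  vertical_link_vsite_plane plane02 rfl B w h

/-- Vertical links of a `(1,2)`-fin: `(vsite B w; 1,2) ∋ (vsite C z, 2)` iff `z = w`, `C ∈ {B, B+e₁}`. -/
theorem vertical_link_plane12 (B : ZMod L × ZMod L) (w : ZMod L) {C : ZMod L × ZMod L} {z : ZMod L}
    (h : pcnt (vsite B w, plane12) (vsite C z, 2) ≠ 0) : z = w ∧ (C = B ∨ C = bump 1 B) :=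
  vertical_link_vsite_plane plane12 rfl B w h

/-- Horizontal links of a `(0,2)`-fin: direction `0`, column `B`, height `w` or `w + 1`. -/
theorem horizontal_link_plane02 (B : ZMod L × ZMod L) (w : ZMod L) {C : ZMod L × ZMod L} {z : ZMod L}
    {k : Fin 3} (hk : k ≠ 2) (h : pcnt (vsite B w, plane02) (vsite C z, k) ≠ 0) :
    k = 0 ∧ C = B ∧ (z = w ∨ z = w + 1) :=
  horizontal_link_vsite_plane plane02 rfl B w hk h

/-- Horizontal links of a `(1,2)`-fin: direction `1`, column `B`, height `w` or `w + 1`. -/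
theorem horizontal_link_plane12 (B : ZMod L × ZMod L) (w : ZMod L) {C : ZMod L × ZMod L} {z : ZMod L}
    {k : Fin 3} (hk : k ≠ 2) (h : pcnt (vsite B w, plane12) (vsite C z, k) ≠ 0) :
    k = 1 ∧ C = B ∧ (z = w ∨ z = w + 1) :=
  horizontal_link_vsite_plane plane12 rfl B w hk h

variable [NeZero L]

/-- Induction around `ℤ/L`: a property of `0` stable under `z ↦ z + 1` holds everywhere. -/
theorem zmod_induction {P : ZMod L → Prop} (h0 : P 0) (hs : ∀ z, P z → P (z + 1)) (z : ZMod L) :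
    P z := by
  have hn : ∀ n : ℕ, P (n : ZMod L) := by
    intro n
    induction n with
    | zero => simpa using h0
    | succ n ih => simpa [Nat.cast_succ] using hs _ ih
  simpa [ZMod.natCast_zmod_val] using hn z.val

variable {c : ℕ}

omit [NeZero L] in
/-- `1, 2, 3 ≢ 0` in `ℤ/L` for `L = 2c`, `c ≥ 2`. -/
theorem one_two_three_ne_zero (hc : 2 ≤ c) (hL : L = 2 * c) :
    (1 : ZMod L) ≠ 0 ∧ (2 : ZMod L) ≠ 0 ∧ (3 : ZMod L) ≠ 0 := by
  refine ⟨?_, ?_, ?_⟩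
  · exact_mod_cast natCast_ne_zero_of_lt (L := L) (k := 1) le_rfl (by omega)
  · exact_mod_cast natCast_ne_zero_of_lt (L := L) (k := 2) (by norm_num) (by omega)
  · exact_mod_cast natCast_ne_zero_of_lt (L := L) (k := 3) (by norm_num) (by omega)

omit [NeZero L] in
/-- **The two layers differ by `2`**: `δ(A') - δ(A) = 2` for `δ(A) = c - 1`, `δ(A') = -(c-1)`,
`L = 2c`. -/
theorem lay_diff_eq_two (hc : 2 ≤ c) (hL : L = 2 * c) {A A' : ZMod L × ZMod L}
    (hA : A.1 - A.2 = ((c - 1 : ℕ) : ZMod L)) (hA' : A'.1 - A'.2 = -((c - 1 : ℕ) : ZMod L)) :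
    (A'.1 - A'.2) - (A.1 - A.2) = 2 := by
  rw [hA, hA']
  have h := cast_pred_add_one (L := L) hc
  have h2 : ((2 * c : ℕ) : ZMod L) = 0 := by rw [← hL]; exact ZMod.natCast_self L
  push_cast at h2
  linear_combination (-2) * h - h2

omit [NeZero L] in
/-- ★ **A top-inner column and a mirror-side column are distinct and not adjacent**
(`L = 2c ≥ 4`). -/
theorem ne_and_not_adj (hc : 2 ≤ c) (hL : L = 2 * c) {A A' : ZMod L × ZMod L}
    (hA : A.1 - A.2 = ((c - 1 : ℕ) : ZMod L)) (hA' : A'.1 - A'.2 = -((c - 1 : ℕ) : ZMod L)) :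
    A ≠ A' ∧ ¬ Adj A A' := by
  obtain ⟨h1, h2, h3⟩ := one_two_three_ne_zero hc hL
  have hd := lay_diff_eq_two hc hL hA hA'
  refine ⟨fun h => h2 ?_, fun hadj => ?_⟩
  · rw [← hd, h, sub_self]
  · obtain ⟨d1, d2, d0⟩ := diff_cases_of_adj hadj
    have e : (A'.1 - A.1) - (A'.2 - A.2) = 2 := by rw [← hd]; ring
    rcases d0 with d | d
    · rw [d, zero_sub] at e
      rcases d2 with d' | d' | d'
      · exact h2 (by rw [← e, d', neg_zero])
      · exact h3 (by linear_combination -d' - e)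
      · exact h1 (by linear_combination -d' - e)
    · rw [d, sub_zero] at e
      rcases d1 with d' | d' | d'
      · exact h2 (by rw [← e, d'])
      · exact h1 (by linear_combination d' - e)
      · exact h3 (by linear_combination d' - e)

end Small

/-! ## The shape theorem -/

section Shape

variable [NeZero L] {c : ℕ}

/-- ★★ **The shape of a rest cover.** `L = 2c`, `c ≥ 2`, `δ(A) = c - 1`, `δ(A') = -(c - 1)`,
`S ⊆ restPlaqs 0 1 c` covering `A'` and `A` with `|S| ≤ 2L`. Then `S` has a lonely link off both
columns, or `A' = A + 2e₀` and `S` is the band of the plane `(0,2)` over `A`, or `A = A' + 2e₁`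
and `S` is the band of the plane `(1,2)` over `A'`, or `A' + e₁ = A + e₀`. -/
theorem rest_shape (hc : 2 ≤ c) (hL : L = 2 * c) {A A' : ZMod L × ZMod L}
    (hA : A.1 - A.2 = ((c - 1 : ℕ) : ZMod L)) (hA' : A'.1 - A'.2 = -((c - 1 : ℕ) : ZMod L))
    {S : Finset (Plaquette 3 L)} (hS : S ⊆ restPlaqs (0 : Fin 3) 1 c) (hcA' : Covers S A')
    (hcA : Covers S A) (hcard : S.card ≤ 2 * L) :
    (∃ p ∈ S, ∃ ℓ : Edge 3 L, pcnt p ℓ ≠ 0 ∧ ccnt A' ℓ = 0 ∧ ccnt A ℓ = 0 ∧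
        ∀ q ∈ S, q ≠ p → pcnt q ℓ = 0) ∨
      (A' = bump 0 (bump 0 A) ∧ S = band A plane02) ∨
        (A = bump 1 (bump 1 A') ∧ S = band A' plane12) ∨ bump 1 A' = bump 0 A := by
  have hL1 : 1 < L := by omega
  obtain ⟨hne, hnadj⟩ := ne_and_not_adj hc hL hA hA'
  obtain ⟨fA, fA', hfA, hfA', hfins⟩ := exists_fins hne hnadj hcA hcA' hcard
  -- the fin types
  have htA : ∀ z, fA z = (vsite A z, plane02) ∨ fA z = (vsite (unbump 1 A) z, plane12) :=
    fun z => rest_fin_low hc hL hA (hS (hfA z).1) (hfA z).2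
  have htA' : ∀ z, fA' z = (vsite (unbump 0 A') z, plane02) ∨ fA' z = (vsite A' z, plane12) :=
    fun z => rest_fin_high hc hL hA' (hS (hfA' z).1) (hfA' z).2
  by_cases H : ∃ p ∈ S, ∃ ℓ : Edge 3 L, pcnt p ℓ ≠ 0 ∧ ccnt A' ℓ = 0 ∧ ccnt A ℓ = 0 ∧
      ∀ q ∈ S, q ≠ p → pcnt q ℓ = 0
  · exact Or.inl H
  right
  push Not at H
  -- adjacency exclusions
  have hx1 : bump 0 A ≠ A' := fun h => hnadj ⟨0, by decide, Or.inl h.symm⟩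
  have hx2 : unbump 0 A' ≠ A := fun h => hnadj ⟨0, by decide, Or.inl (by rw [← h, bump_unbump])⟩
  have hx3 : unbump 1 A ≠ A' := fun h => hnadj ⟨1, by decide, Or.inr (by rw [← h, bump_unbump])⟩
  have hbA : bump 0 A ≠ A := bump_ne_self hL1 (by decide) A
  have hu1A : unbump 1 A ≠ A := fun h =>
    bump_ne_self hL1 (show (1 : Fin 3) ≠ 2 by decide) (unbump 1 A) (by rw [bump_unbump]; exact h.symm)
  have h01 : (0 : Fin 3) ≠ 1 := by decide
  have h10 : (1 : Fin 3) ≠ 0 := by decide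
  have h02 : (0 : Fin 3) ≠ 2 := by decide
  have h12 : (1 : Fin 3) ≠ 2 := by decide
  -- UNIFORM TYPES along `A`: a type-0 fin below a type-1 fin has a lonely top rung
  have hstepA0 : ∀ z, fA z = (vsite A z, plane02) → fA (z + 1) = (vsite A (z + 1), plane02) := by
    intro z hz
    rcases htA (z + 1) with h1 | h1
    · exact h1
    exfalso
    obtain ⟨q, hqS, hqp, hq⟩ := H (fA z) (hfA z).1 (vsite A (z + 1), 0)
      (by rw [hz]; exact pcnt_top_rung_ne_zero plane02 rfl A z)
      (ccnt_of_snd_ne_two A' h02) (ccnt_of_snd_ne_two A h02)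
    rcases hfins q hqS with ⟨w, rfl⟩ | ⟨w, rfl⟩
    · rcases htA w with hw | hw
      · rw [hw] at hq
        obtain ⟨-, -, hzw | hzw⟩ := horizontal_link_plane02 A w h02 hq
        · rw [← hzw, h1] at hw
          exact plane02_ne_plane12 (congrArg Prod.snd hw).symm
        · exact hqp (by rw [add_right_cancel hzw])
      · rw [hw] at hq
        exact h01 (horizontal_link_plane12 _ w h02 hq).1
    · rcases htA' w with hw | hw
      · rw [hw] at hq
        exact hx2 (horizontal_link_plane02 _ w h02 hq).2.1.symm
      · rw [hw] at hq
        exact h01 (horizontal_link_plane12 _ w h02 hq).1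
  have hstepA1 : ∀ z, fA z = (vsite (unbump 1 A) z, plane12) →
      fA (z + 1) = (vsite (unbump 1 A) (z + 1), plane12) := by
    intro z hz
    rcases htA (z + 1) with h1 | h1
    swap
    · exact h1
    exfalso
    obtain ⟨q, hqS, hqp, hq⟩ := H (fA z) (hfA z).1 (vsite (unbump 1 A) (z + 1), 1)
      (by rw [hz]; exact pcnt_top_rung_ne_zero plane12 rfl (unbump 1 A) z)
      (ccnt_of_snd_ne_two A' h12) (ccnt_of_snd_ne_two A h12)
    rcases hfins q hqS with ⟨w, rfl⟩ | ⟨w, rfl⟩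
    · rcases htA w with hw | hw
      · rw [hw] at hq
        exact h10 (horizontal_link_plane02 _ w h12 hq).1
      · rw [hw] at hq
        obtain ⟨-, -, hzw | hzw⟩ := horizontal_link_plane12 _ w h12 hq
        · rw [← hzw, h1] at hw
          exact plane02_ne_plane12 (congrArg Prod.snd hw)
        · exact hqp (by rw [add_right_cancel hzw])
    · rcases htA' w with hw | hw
      · rw [hw] at hq
        exact h10 (horizontal_link_plane02 _ w h12 hq).1
      · rw [hw] at hq
        exact hx3 (horizontal_link_plane12 _ w h12 hq).2.1
  -- UNIFORM TYPES along `A'`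
  have hstepA'0 : ∀ z, fA' z = (vsite (unbump 0 A') z, plane02) →
      fA' (z + 1) = (vsite (unbump 0 A') (z + 1), plane02) := by
    intro z hz
    rcases htA' (z + 1) with h1 | h1
    · exact h1
    exfalso
    obtain ⟨q, hqS, hqp, hq⟩ := H (fA' z) (hfA' z).1 (vsite (unbump 0 A') (z + 1), 0)
      (by rw [hz]; exact pcnt_top_rung_ne_zero plane02 rfl (unbump 0 A') z)
      (ccnt_of_snd_ne_two A' h02) (ccnt_of_snd_ne_two A h02)
    rcases hfins q hqS with ⟨w, rfl⟩ | ⟨w, rfl⟩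
    · rcases htA w with hw | hw
      · rw [hw] at hq
        exact hx2 (horizontal_link_plane02 _ w h02 hq).2.1
      · rw [hw] at hq
        exact h01 (horizontal_link_plane12 _ w h02 hq).1
    · rcases htA' w with hw | hw
      · rw [hw] at hq
        obtain ⟨-, -, hzw | hzw⟩ := horizontal_link_plane02 _ w h02 hq
        · rw [← hzw, h1] at hw
          exact plane02_ne_plane12 (congrArg Prod.snd hw).symm
        · exact hqp (by rw [add_right_cancel hzw])
      · rw [hw] at hq
        exact h01 (horizontal_link_plane12 _ w h02 hq).1
  have hstepA'1 : ∀ z, fA' z = (vsite A' z, plane12) → fA' (z + 1) = (vsite A' (z + 1), plane12) := by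
    intro z hz
    rcases htA' (z + 1) with h1 | h1
    swap
    · exact h1
    exfalso
    obtain ⟨q, hqS, hqp, hq⟩ := H (fA' z) (hfA' z).1 (vsite A' (z + 1), 1)
      (by rw [hz]; exact pcnt_top_rung_ne_zero plane12 rfl A' z)
      (ccnt_of_snd_ne_two A' h12) (ccnt_of_snd_ne_two A h12)
    rcases hfins q hqS with ⟨w, rfl⟩ | ⟨w, rfl⟩
    · rcases htA w with hw | hw
      · rw [hw] at hq
        exact h10 (horizontal_link_plane02 _ w h12 hq).1
      · rw [hw] at hq
        exact hx3 (horizontal_link_plane12 _ w h12 hq).2.1.symm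
    · rcases htA' w with hw | hw
      · rw [hw] at hq
        exact h10 (horizontal_link_plane02 _ w h12 hq).1
      · rw [hw] at hq
        obtain ⟨-, -, hzw | hzw⟩ := horizontal_link_plane12 _ w h12 hq
        · rw [← hzw, h1] at hw
          exact plane02_ne_plane12 (congrArg Prod.snd hw)
        · exact hqp (by rw [add_right_cancel hzw])
  have huA : (∀ z, fA z = (vsite A z, plane02)) ∨ (∀ z, fA z = (vsite (unbump 1 A) z, plane12)) := by
    rcases htA 0 with h0 | h0
    · exact Or.inl (zmod_induction (P := fun z => fA z = (vsite A z, plane02)) h0 hstepA0)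
    · exact Or.inr (zmod_induction (P := fun z => fA z = (vsite (unbump 1 A) z, plane12)) h0 hstepA1)
  have huA' : (∀ z, fA' z = (vsite (unbump 0 A') z, plane02)) ∨
      (∀ z, fA' z = (vsite A' z, plane12)) := by
    rcases htA' 0 with h0 | h0
    · exact Or.inl (zmod_induction (P := fun z => fA' z = (vsite (unbump 0 A') z, plane02)) h0
        hstepA'0)
    · exact Or.inr (zmod_induction (P := fun z => fA' z = (vsite A' z, plane12)) h0 hstepA'1)
  have hcard' : 2 * L ≤ S.card := two_mul_le_card_of_covers_of_not_adj hne hnadj hcA hcA'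
  -- MATCHING the outer column of the fin over `A` at height `0`
  rcases huA with huA0 | huA1
  · -- type 0: outer vertical link over `A + e₀`
    obtain ⟨q, hqS, hqp, hq⟩ := H (fA 0) (hfA 0).1 (vsite (bump 0 A) 0, 2)
      (by rw [huA0 0]; exact pcnt_outer_ne_zero plane02 rfl A 0)
      (ccnt_vsite_of_ne hx1 0) (ccnt_vsite_of_ne hbA 0)
    rcases hfins q hqS with ⟨w, rfl⟩ | ⟨w, rfl⟩
    · exfalso
      rw [huA0 w] at hq
      obtain ⟨hw, -⟩ := vertical_link_plane02 A w hq
      exact hqp (by rw [hw])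
    · rcases huA' with huA'0 | huA'1
      · rw [huA'0 w] at hq
        obtain ⟨-, hC | hC⟩ := vertical_link_plane02 (unbump 0 A') w hq
        · -- `A' - e₀ = A + e₀`: the band of the plane `(0,2)` over `A`
          left
          refine ⟨by rw [← bump_unbump 0 A', ← hC], eq_of_subset_of_card_le (fun p hp => ?_) ?_⟩
          · unfold band
            rcases hfins p hp with ⟨z, rfl⟩ | ⟨z, rfl⟩
            · rw [huA0 z]; exact mem_union_left _ (mem_ladder.2 ⟨z, rfl⟩)
            · rw [huA'0 z, ← hC]; exact mem_union_right _ (mem_ladder.2 ⟨z, rfl⟩)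
          · rw [card_band hL1 A plane02 rfl]; exact hcard'
        · exact absurd (by rw [hC, bump_unbump]) hx1
      · rw [huA'1 w] at hq
        obtain ⟨-, hC | hC⟩ := vertical_link_plane12 A' w hq
        · exact absurd hC hx1
        · right; right; exact hC.symm
  · -- type 1: outer vertical link over `A - e₁`
    obtain ⟨q, hqS, hqp, hq⟩ := H (fA 0) (hfA 0).1 (vsite (unbump 1 A) 0, 2)
      (by rw [huA1 0]; exact pcnt_inner_ne_zero plane12 rfl (unbump 1 A) 0)
      (ccnt_vsite_of_ne hx3 0) (ccnt_vsite_of_ne hu1A 0)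
    rcases hfins q hqS with ⟨w, rfl⟩ | ⟨w, rfl⟩
    · exfalso
      rw [huA1 w] at hq
      obtain ⟨hw, -⟩ := vertical_link_plane12 (unbump 1 A) w hq
      exact hqp (by rw [hw])
    · rcases huA' with huA'0 | huA'1
      · rw [huA'0 w] at hq
        obtain ⟨-, hC | hC⟩ := vertical_link_plane02 (unbump 0 A') w hq
        · -- `A - e₁ = A' - e₀`
          right; right
          calc bump 1 A' = bump 1 (bump 0 (unbump 0 A')) := by rw [bump_unbump]
            _ = bump 0 (bump 1 (unbump 0 A')) := (bump_zero_bump_one _).symm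
            _ = bump 0 A := by rw [← hC, bump_unbump]
        · exact absurd (by rw [hC, bump_unbump]) hx3
      · rw [huA'1 w] at hq
        obtain ⟨-, hC | hC⟩ := vertical_link_plane12 A' w hq
        · exact absurd hC hx3
        · -- `A - e₁ = A' + e₁`: the band of the plane `(1,2)` over `A'`
          right; left
          refine ⟨by rw [← bump_unbump 1 A, hC], eq_of_subset_of_card_le (fun p hp => ?_) ?_⟩
          · unfold band
            rcases hfins p hp with ⟨z, rfl⟩ | ⟨z, rfl⟩
            · rw [huA1 z, hC]; exact mem_union_right _ (mem_ladder.2 ⟨z, rfl⟩)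
            · rw [huA'1 z]; exact mem_union_left _ (mem_ladder.2 ⟨z, rfl⟩)
          · rw [card_band hL1 A' plane12 rfl]; exact hcard'

end Shape

end DiagRPRest

end Summit.QuantumFields.GaugeBoot
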